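/- Copyright: the b2b-balaban cell (near-miss cell 7), T⁴-continuum fan-out, ROUND-2 swarm `t4-ne7b-formalise-*`
(leaf 08, gen 2), row NE7b (node U5c COUNT member).  Released under the licence of the surrounding project. -/
import Summits.QuantumFields.BalabanUV.T4Continuum.Support.HistoryRealiseCellsEnd
import Summits.QuantumFields.BalabanUV.T4Continuum.Support.HistoryGenOrder

/-!
# Realised histories: the displayed reading with domains is INHABITED (sanity companion of row S12c)

Summits-side support leaf of the T⁴-continuum cell (rung (B)+1 on a FINITE torus only; NOT infinite volume, NOT the
mass gap, NOT the Clay statement; NOT a proof of the spine estimate NE7b).  Sanity companion of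
`Support/HistoryRealiseCells.lean` (p211546): the hypothesis shape `RealisedDomains` — encoding facts, `real` (with the
domain), `track`, `disjoint`, `inBox` — is JOINTLY SATISFIABLE, and `realisedReading_of_domains` then yields an inhabited
`HistoryAssemblyRealiseLE.RealisedReading` (leaf-03's END binder) with the two cell fields proved.  The toy: one cutoff
`K₀ = K = 0`, ONE bad term with TWO live components, each a single NEW region of class `0` (a one-cube region of `ℤ¹`,
anchored at itself) at the cubes `0` and `50`; torus `100·4^0` cubes a side; constant exponent profile.  [folklore]
decided ∕ one-line checks on OUR carriers; nothing printed is asserted; no `[cite:]`; toy `def`s only.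

HONEST.  A toy inhabitant, not a reading of any term of Bałaban's; NE7b NOT proved; spine 0∕9.  HONEST DEPENDENCY
(cell): continuum YM on T⁴ ⇐ BetaPertH ∧ nine spine estimates (0/9 proved); BetaPertH ⇐ (D1) ∧ (D4) ∧ CAP+tail; G-an2-4
gates asym, D1 and NE2/3/4.  This file changes none of it. -/

open Finset
open Literature.MathematicalPhysics.QuantumFieldTheory.Balaban1983to89
open Literature.MathematicalPhysics.QuantumFieldTheory.Balaban1983to89.B13ScaleTransfer
open Literature.MathematicalPhysics.QuantumFieldTheory.Balaban1983to89.TreeLength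
open Literature.MathematicalPhysics.QuantumFieldTheory.Balaban1983to89.B16SProfile
open Literature.MathematicalPhysics.QuantumFieldTheory.Balaban1983to89.B16MergeGeometry.OneDim
open T4PersistenceDictionary
open Summit.QuantumFields.BalabanUV.T4Continuum.HistoryTables
open Summit.QuantumFields.BalabanUV.T4Continuum.HistoryGen
open Summit.QuantumFields.BalabanUV.T4Continuum.HistoryAdmissible
open Summit.QuantumFields.BalabanUV.T4Continuum.HistoryAssemblyRealiseLE
open Summit.QuantumFields.BalabanUV.T4Continuum.HistoryRealise
open Summit.QuantumFields.BalabanUV.T4Continuum.HistoryRealiseCells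
open Summit.QuantumFields.BalabanUV.T4Continuum.HistoryRealiseCellsEnd

namespace Summit.QuantumFields.BalabanUV.T4Continuum.HistoryRealiseCellsWitness

noncomputable section

/-! ## The toy reading -/

/-- the payload of a live component: (anchor, region) = a single cube anchored at itself, at `0` and at `50` [folklore] -/
def payload : Fin 2 → Pt 1 × Finset (Pt 1) := fun c => if c = 0 then (pt 0, {pt 0}) else (pt 50, {pt 50})

/-- the toy pedigree: two components, each ONE new part of class `0`, at step `0` [folklore] -/
def pedW : Pedigree (Fin 2) (Fin 2) where
  step := fun _ => 0
  parts := fun c => [Part.new 0 c]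
  step_lt := fun c c' r h => by simp at h

/-- the terms: one term at cutoff `0`, none later [folklore] -/
def TW : ℕ → Finset Unit := fun K => if K = 0 then {()} else ∅

/-- the reading map: pedigree, payloads, live components, domains [folklore] -/
def pedR : ℕ → Unit → Pedigree (Fin 2) (Fin 2) := fun _ _ => pedW
/-- payload map [folklore] -/
def cellPR : ℕ → Unit → Fin 2 → Pt 1 × Finset (Pt 1) := fun _ _ => payload
/-- live components: both [folklore] -/
def liveR : ℕ → Unit → Finset (Fin 2) := fun _ _ => Finset.univ
/-- domains: the regions themselves [folklore] -/
def ZR : ℕ → Unit → Fin 2 → Finset (Pt 1) := fun _ _ c => (payload c).2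
/-- sizes: `R ≡ 2` [folklore] -/
def RR : ℕ → ℕ → ℕ := fun _ _ => 2

/-- a term lives only at cutoff `0` [folklore] -/
theorem mem_TW {K : ℕ} {τ : Unit} (h : τ ∈ TW K) : K = 0 := by
  by_contra hK
  simp [TW, hK] at h

/-- the region history of a component is the birth of its region [folklore] -/
theorem toPGen_pedW (c : Fin 2) : pedW.toPGen payload c = PGen.birth 0 0 (payload c) := by
  rw [Pedigree.toPGen_eq]
  rfl

/-- the toy regions realise their births [folklore] -/
theorem realises_payload (L : ℕ) (s R : ℕ → ℕ) (c : Fin 2) :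
    Realises L s R (PGen.birth 0 0 (payload c)) (payload c).2 := by
  have key : ∀ k : ℤ, Realises L s R (PGen.birth 0 0 (pt k, ({pt k} : Finset (Pt 1)))) {pt k} := fun k =>
    ⟨rfl, mem_singleton_self _,
      fun x hx y hy => by rw [mem_singleton] at hx hy; subst hx; subst hy; exact Relation.ReflTransGen.refl,
      by rw [treeLen_singleton]; norm_num⟩
  unfold payload
  split_ifs <;> exact key _

/-- nothing stops at index `0`, so a domain formed at the cutoff is pending there [folklore] -/
theorem pendingAt_zero (L : ℕ) (s R : ℕ → ℕ) (Z : Finset (Pt 1)) : PendingAt L s R 0 Z 0 :=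
  ⟨le_rfl, fun k hk hS => by have := hS.pos; omega⟩

/-- **THE TOY READING SATISFIES `RealisedDomains`** (torus `100·4^K`, constant profile `0`, sizes `2`). [folklore] -/
theorem realisedDomains_toy : RealisedDomains 4 (fun _ => 0) 100 0 RR TW pedR cellPR liveR ZR where
  renew_step K hK τ hτ c c' h := by simp [pedR, pedW] at h
  forest K hK τ hτ c := List.pairwise_singleton _ _
  headOldest K hK τ hτ c := Pedigree.headOldest_of_single (p := Part.new 0 c) rfl
  real K hK τ hτ c hc := by
    obtain rfl := mem_TW hτ
    show Realises 4 (fun _ => 0) (RR 0) (pedW.toPGen payload c) (payload c).2 ∧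
      PendingAt 4 (fun _ => 0) (RR 0) (pedW.toPGen payload c).lastStep (payload c).2 0
    rw [toPGen_pedW]
    exact ⟨realises_payload 4 _ _ c, pendingAt_zero 4 _ _ _⟩
  track K hK τ hτ c hc := by
    obtain rfl := mem_TW hτ
    show anchorAt 4 (fun _ => 0) (pedW.toPGen payload c) (pedW.toPGen payload c).lastStep ∈ (payload c).2
    rw [toPGen_pedW]
    exact tracks_birth (realises_payload 4 (fun _ => 0) (RR 0) c)
  disjoint K hK τ hτ c hc c' hc' hne := by
    obtain rfl := mem_TW hτ
    show Disjoint (curDomain 4 (fun _ => 0) (pedW.toPGen payload c) (payload c).2 0)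
      (curDomain 4 (fun _ => 0) (pedW.toPGen payload c') (payload c').2 0)
    rw [toPGen_pedW, toPGen_pedW]
    simp only [curDomain, PGen.lastStep, Nat.sub_self, orbit_zero]
    have h01 : Disjoint ({pt 0} : Finset (Pt 1)) {pt 50} := by
      rw [disjoint_singleton]; intro h; have := congrFun h 0; simp [pt] at this
    fin_cases c <;> fin_cases c'
    · exact absurd rfl hne
    · simpa [payload] using h01
    · simpa [payload] using h01.symm
    · exact absurd rfl hne
  inBox K hK τ hτ c hc i := by
    obtain rfl := mem_TW hτ
    show 0 ≤ rootAnchor (pedW.toPGen payload c) i ∧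
      4 ^ HistoryZones.levelOf (fun _ => 0) 0 (pedW.toPGen payload c).rootStep *
        (rootAnchor (pedW.toPGen payload c) i).toNat < 100 * 4 ^ 0
    rw [toPGen_pedW]
    simp only [rootAnchor, PGen.rootCell, PGen.rootStep, HistoryZones.levelOf_K, pow_zero, one_mul, mul_one]
    unfold payload
    split_ifs <;> simp [pt]

/-- **HENCE AN INHABITED `RealisedReading`** (leaf-03's END binder) with root cells `cellOfA`, the two cell fields
PROVED by `realisedReading_of_domains` (`L = 4`, `n = 100`, constant profile, `DropCtl` of a constant). [folklore] -/
theorem realisedReading_toy :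
    RealisedReading 4 (fun _ => 0) (cellN 1 100 4) 0 RR TW pedR cellPR liveR
      (cellOfA 100 4 (fun _ => 0) pedR cellPR) :=
  realisedReading_of_domains (by norm_num) (by norm_num) (fun _ => le_rfl) (fun m => B16Absorption.dropCtl_const 0 m)
    realisedDomains_toy

/-- and the two root cells ARE distinct: `0` and `50` (the corner cells at level `0`) [folklore] -/
example : cellOfA 100 4 (fun _ => 0) pedR cellPR 0 () 0 ≠ cellOfA 100 4 (fun _ => 0) pedR cellPR 0 () 1 := by
  intro h
  have := congrFun h 0
  simp [cellOfA, pedR, cellPR, toPGen_pedW, cornerCell, rootAnchor, PGen.rootCell, PGen.rootStep, payload, pt,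
    HistoryZones.levelOf_K] at this

end

end Summit.QuantumFields.BalabanUV.T4Continuum.HistoryRealiseCellsWitness
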